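import Literature.Analysis.FluidPDE.PalasekCylindricalCarleman
import Literature.Analysis.FluidPDE.TaoMainEstimateFirstCarleman
import HarnessLib

/-!
# Palasek 2021, Prop. 11: the cylindrical Carleman inequality (Prop. 9) applied to the
# backward vorticity

Analysis/FluidPDE proof file (theorems only, no definitions, no named facts), a step of the
inline programme for `Literature.Analysis.FluidPDE.palasek2021_axisym_quantitative_ess`
(S. Palasek, *Improved quantitative regularity for the Navier–Stokes equations in a scale of
critical spaces*, arXiv:2101.08586, Thm. 1 with `q = 3`).

Palasek, §5, proof of Prop. 11 (the main estimate), after the off-axis regularity (Prop. 8) has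
supplied the pointwise bounds `|∇ʲu| ≲ A₆^{−2}T₂^{−(j+1)/2}`, `|∇ʲω| ≲ A₆^{−2}T₂^{−(j+2)/2}`
(`j = 0, 1`) on `[−T₂, 0] × {r ≥ A₅T₂^{1/2}}`: "we apply Proposition 9 [the backward-uniqueness
Carleman inequality in truncated cylindrical shells] on the slab `[0, T₂/C₀] × ℝ³` with
`r₋ := A₅²T₂^{1/2}`-type inner radius and `r₊ := A₆T₂^{1/2}`, and `u` replaced by
`(t, x) ↦ ω(−t, x)`, so that the hypothesis (the differential inequality
`|∂ₜω + Δω| ≤ (C₀T)⁻¹|ω| + (C₀T)^{−1/2}|∇ω|` on the shell) follows from the vorticity equation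
and the pointwise bounds" — exactly as Tao, arXiv:1908.04958v2, p. 38, does with his Prop. 4.2
on spherical annuli (`TaoMainEstimateFirstCarleman.lean`).

This file performs this application for the tree's rendering of Prop. 9
(`PalasekCarleman.cyl_carleman_inequality`, `PalasekCylindricalCarleman.lean`): for a classical
solution of the unforced Navier–Stokes equations on `[b − T, b] × ℝ³` whose velocity obeys
`|u| ≤ T^{−1/2}`, `|∇u| ≤ T⁻¹` on the cylindrical shell `R₁² ≤ |x|² − ⟪x,a⟫² ≤ R₂²` about the
axis `ℝa` (`‖a‖ = 1`; no restriction along the axis, as supplied by Prop. 8), the backward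
vorticity `U(s, x) = ω(b − s, x)` satisfies the Carleman hypothesis on the slab `[0, T/C₀]`
(pointwise lemma `IsClassicalNSSolutionOn.backwardVorticity_carleman_ineq_at` of the tree) at
every point of the truncated shell, whence Prop. 9 for `U` between radii `R₁ ≤ r₁ < r₂ ≤ R₂`:
`IsClassicalNSSolutionOn.cyl_carleman_vorticity`.

## References

* S. Palasek, arXiv:2101.08586 (ARMA 242 (2021) 1479–1531), Prop. 9 (§4) and §5, proof of
  Prop. 11. [Palasek2021]
* T. Tao, arXiv:1908.04958v2 (2021), Prop. 4.2 and proof of Thm. 5.1, p. 38.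
  [Tao2021QuantitativeNS]
-/

noncomputable section

open MeasureTheory Set Function Filter Topology Metric
open scoped Laplacian ContDiff RealInnerProductSpace

namespace Literature.Analysis.FluidPDE

section CylCarlemanVorticity

variable {a b : ℝ} {u : ℝ → EuclideanSpace ℝ (Fin 3) → EuclideanSpace ℝ (Fin 3)}
  {p : ℝ → EuclideanSpace ℝ (Fin 3) → ℝ}

/-- **Prop. 9 applied to the backward vorticity** (Palasek, proof of Prop. 11; the cylindrical
counterpart of Tao, proof of Thm. 5.1, p. 38). There is an absolute `K > 0` such that: for every
classical solution `(u, p)` of the unforced Navier–Stokes equations on `[b − T, b] × ℝ³`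
(`T > 0`), every unit vector `a`, with `|u(t, x)| ≤ T^{-1/2}` and `‖∇u(t, x)‖ ≤ T⁻¹` for
`t ∈ [b − T, b]` and `R₁² ≤ |x|² − ⟪x,a⟫² ≤ R₂²`, every `C₀ ≥ 1` and radii `R₁ ≤ r₁ < r₂ ≤ R₂`
(`R₁ ≥ 0`) with `4T ≤ r₁²`, the backward vorticity `U(s, x) = ω(b − s, x)` on the slab `[0, T/C₀]`
obeys, with `m(x) = |x|² − ⟪x,a⟫²` and `ζ(x) = ⟪x,a⟫`,
`∫₀^{T/4C₀}∫_{100r₁²<m<r₂²/4, ζ²<r₂²/4} ((T/C₀)⁻¹|U|² + ‖∇U‖²)`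
`≤ K C₀³ e^{−r₁r₂/(4T)} ( ∫₀^{T/C₀}∫_{r₁²<m<r₂², ζ²<r₂²} e^{2|x|²/T}((T/C₀)⁻¹|U|² + ‖∇U‖²) + e^{3r₂²/T} ∫_{r₁²<m<r₂², ζ²<r₂²} |ω(b, x)|² )`.
[cite: Palasek2021, Prop. 9 and §5 proof of Prop. 11] [cite: Tao2021QuantitativeNS, Thm. 5.1 proof p. 38] -/
theorem IsClassicalNSSolutionOn.cyl_carleman_vorticity :
    ∃ K : ℝ, 0 < K ∧ ∀ ⦃b T : ℝ⦄ ⦃u : ℝ → EuclideanSpace ℝ (Fin 3) → EuclideanSpace ℝ (Fin 3)⦄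
      ⦃p : ℝ → EuclideanSpace ℝ (Fin 3) → ℝ⦄,
      IsClassicalNSSolutionOn (Icc (b - T) b) 1 0 u p → 0 < T →
      ∀ (a : EuclideanSpace ℝ (Fin 3)), ‖a‖ = 1 →
      ∀ ⦃C₀ R₁ R₂ r₁ r₂ : ℝ⦄, 1 ≤ C₀ → 0 < r₁ → r₁ < r₂ → 4 * T ≤ r₁ ^ 2 → 0 ≤ R₁ → R₁ ≤ r₁ → r₂ ≤ R₂ →
      (∀ t ∈ Icc (b - T) b, ∀ x : EuclideanSpace ℝ (Fin 3), R₁ ^ 2 ≤ ‖x‖ ^ 2 - ⟪x, a⟫ ^ 2 →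
          ‖x‖ ^ 2 - ⟪x, a⟫ ^ 2 ≤ R₂ ^ 2 → ‖u t x‖ ≤ (Real.sqrt T)⁻¹ ∧ ‖fderiv ℝ (u t) x‖ ≤ T⁻¹) →
      ∫ s in (0 : ℝ)..T / C₀ / 4, ∫ x in {y : EuclideanSpace ℝ (Fin 3) |
          100 * r₁ ^ 2 < ‖y‖ ^ 2 - ⟪y, a⟫ ^ 2 ∧ ‖y‖ ^ 2 - ⟪y, a⟫ ^ 2 < r₂ ^ 2 / 4 ∧ ⟪y, a⟫ ^ 2 < r₂ ^ 2 / 4},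
          ((T / C₀)⁻¹ * ‖vorticity u (b - s) x‖ ^ 2 + ‖fderiv ℝ (vorticity u (b - s)) x‖ ^ 2) ≤
        K * C₀ ^ 3 * Real.exp (-(r₁ * r₂) / (4 * T)) *
          ((∫ s in (0 : ℝ)..T / C₀, ∫ x in {y : EuclideanSpace ℝ (Fin 3) |
              r₁ ^ 2 < ‖y‖ ^ 2 - ⟪y, a⟫ ^ 2 ∧ ‖y‖ ^ 2 - ⟪y, a⟫ ^ 2 < r₂ ^ 2 ∧ ⟪y, a⟫ ^ 2 < r₂ ^ 2},
              Real.exp (2 * ‖x‖ ^ 2 / T) *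
                ((T / C₀)⁻¹ * ‖vorticity u (b - s) x‖ ^ 2 + ‖fderiv ℝ (vorticity u (b - s)) x‖ ^ 2)) +
            Real.exp (3 * r₂ ^ 2 / T) *
              ∫ x in {y : EuclideanSpace ℝ (Fin 3) |
                  r₁ ^ 2 < ‖y‖ ^ 2 - ⟪y, a⟫ ^ 2 ∧ ‖y‖ ^ 2 - ⟪y, a⟫ ^ 2 < r₂ ^ 2 ∧ ⟪y, a⟫ ^ 2 < r₂ ^ 2},
                ‖vorticity u b x‖ ^ 2) := by
  have hd : Module.finrank ℝ (EuclideanSpace ℝ (Fin 3)) = 3 := finrank_euclideanSpace_fin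
  obtain ⟨K, hK, hC⟩ := PalasekCarleman.cyl_carleman_inequality
    (E := EuclideanSpace ℝ (Fin 3)) (F := EuclideanSpace ℝ (Fin 3)) hd
  refine ⟨K, hK, fun b T u p h hT a ha C₀ R₁ R₂ r₁ r₂ hC₀ hr₁ hr₁₂ hr₁T hR₁0 hR₁ hR₂ hbd => ?_⟩
  have hab : b - T < b := by linarith
  have hC₀0 : 0 < C₀ := by linarith
  have hτ : 0 < T / C₀ := div_pos hT hC₀0
  have hCτ : C₀ * (T / C₀) = T := by field_simp
  -- smoothness of the backward vorticity on `[0, T/C₀]`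
  have hU2 : ContDiffOn ℝ 2 (uncurry fun s z => vorticity u (b - s) z) (Icc 0 (T / C₀) ×ˢ univ) := by
    have h1 := (h.contDiffOn_backwardVorticity hab 0).of_le (m := 2) (by norm_cast)
    simp only [zero_add] at h1
    rw [show b - (b - T) = T by ring] at h1
    refine h1.mono (prod_mono (Icc_subset_Icc le_rfl ?_) subset_rfl)
    exact div_le_self hT.le hC₀
  -- the Carleman hypothesis on the truncated shell
  have hL : ∀ s ∈ Ioo 0 (T / C₀), ∀ x : EuclideanSpace ℝ (Fin 3), r₁ ^ 2 ≤ ‖x‖ ^ 2 - ⟪x, a⟫ ^ 2 →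
      ‖x‖ ^ 2 - ⟪x, a⟫ ^ 2 ≤ r₂ ^ 2 → ⟪x, a⟫ ^ 2 ≤ r₂ ^ 2 →
      ‖FluidPDE.timeDeriv (fun s z => vorticity u (b - s) z) s x +
          (Δ ((fun s z => vorticity u (b - s) z) s)) x‖ ≤
        (C₀ * (T / C₀))⁻¹ * ‖(fun s z => vorticity u (b - s) z) s x‖ +
          (Real.sqrt (C₀ * (T / C₀)))⁻¹ * ‖fderiv ℝ ((fun s z => vorticity u (b - s) z) s) x‖ := by
    intro s hs x hx₁ hx₂ _
    have hxR₁ : R₁ ^ 2 ≤ ‖x‖ ^ 2 - ⟪x, a⟫ ^ 2 := (pow_le_pow_left₀ hR₁0 hR₁ 2).trans hx₁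
    have hxR₂ : ‖x‖ ^ 2 - ⟪x, a⟫ ^ 2 ≤ R₂ ^ 2 :=
      hx₂.trans (pow_le_pow_left₀ (by linarith) hR₂ 2)
    have hs' : s ∈ Ioo 0 (b - (b - T)) := by
      rw [show b - (b - T) = T by ring]
      exact ⟨hs.1, hs.2.trans_le (div_le_self hT.le hC₀)⟩
    have key := h.backwardVorticity_carleman_ineq_at hab
      (fun t ht => (hbd t ht x hxR₁ hxR₂).1) (fun t ht => (hbd t ht x hxR₁ hxR₂).2) hs'
    rw [hCτ]
    simpa only using key
  have h4 : 4 * C₀ * (T / C₀) = 4 * T := by rw [mul_assoc, hCτ]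
  have hmain := hC a ha (T / C₀) C₀ r₁ r₂ (fun s z => vorticity u (b - s) z) hτ hC₀ hr₁ hr₁₂
    (by rw [h4]; exact hr₁T) hU2 hL
  simp only [h4, hCτ, sub_zero] at hmain
  exact hmain

end CylCarlemanVorticity

end Literature.Analysis.FluidPDE

end
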